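import Summits.AnomalousDissipation.AnomalousDissipation.Theorems.SolenoidalFractalHomogenisationLagrangianStepCellCorrectorContent
import Summits.AnomalousDissipation.AnomalousDissipation.Theorems.SolenoidalFractalHomogenisationLagrangianStepCellClauseCutsW
import Summits.AnomalousDissipation.AnomalousDissipation.Theorems.SolenoidalFractalHomogenisationLagrangianStepCarrierFastContent
import Summits.AnomalousDissipation.AnomalousDissipation.Theorems.SolenoidalFractalHomogenisationLagrangianStepMeanConservation
import Summits.AnomalousDissipation.AnomalousDissipation.Theorems.SolenoidalFractalHomogenisationLagrangianStepSectorCount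
import Literature.Analysis.FluidPDE.PassiveVectorTensorLionsExistence
import Literature.Analysis.FluidPDE.PassiveVectorTensorWeakContinuity
import Literature.Analysis.FunctionSpaces.TimeMollification
import HarnessLib

/-!
# K1L_D `stub_cellEnergyT` by DUALITY, part 1/3: vocabulary — the reversed carrier, the duality Props, transversal vectors

Part 1 of the dual (uniform-in-`T`) proof of clause (F) of the tensor cell package: the adjoint carrier `revCarrier b t₀ = (r,x) ↦ −b(t₀−r,x)` and
its cell-field facts; the intermediate statement names `PairingConst` (D1), `DualityBound`, `UniformSlowLeak`, `SlowModeBound`, `SectorCount`,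
`MeanConservation` (the last two PROVED here by name from p638936 / p638532); the transversal frame `transVec ℓ j = e_j − (ℓ_j/|ℓ|²) ℓ` and its algebra.

Provenance: the TEXT of every declaration below is planner `ad-ideate-p4` g10's PORT-READY crux workfile
`Cruxes/LagrangianRenormalisationStep/CellEnergyTPort.lean` v2 (commit f414c08b2b27, sha16 2d92a09157a6ab13; finding F-p4g10-1, lens «control»;
`lean check` rc 0 / 0 sorry), split VERBATIM into three Theorems files of ≤ 400 lines (`…CellEnergyTDualDefs` → `…CellEnergyTDualLeak` →
`…CellEnergyTDual`) by prover seat `ad-k3l-bookkeeping-p1` g4 (cell STATUS 2026-08-28T14:13:02Z O4 / 14:28:06Z), with the one hypothesis D1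
`PairingConst` DISCHARGED in the last file from ad-lit g25's `Literature.Analysis.FluidPDE.PassiveVectorTensorDuality` (p640160).  The registered
stub `stub_cellEnergyT` of K1L_D (stmt-AnomalousDissipation-27980) is ALREADY CLOSED by name by the lead's primal proof (p640158, `cellEnergyT_W`);
this chain is the independent DUAL proof, giving the STRONGER uniform-in-`T` clause (F) (`CellEnergyClausesNoE`, the v21 text) and (F_T) a fortiori
(`--supports stmt-AnomalousDissipation-27980 --as helper`; no registered stub name is redeclared).  Infrastructure for route-1's rung leaf F-D1.A0
(a frontier FORMAL rung); NOT a proof of the crux, of Onsager's conjecture or of anomalous dissipation.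
-/

set_option linter.dupNamespace false

noncomputable section

namespace Summit.AnomalousDissipation.AnomalousDissipation.Theorems.SolenoidalFractalHomogenisation.LagrangianStep.CellEnergyT

open Literature.Analysis Literature.Analysis.FluidPDE Literature.Analysis.FunctionSpaces
open Literature.Analysis.FluidPDE.LatticeShear
open MeasureTheory Set Filter Function UnitAddTorus
open scoped ENNReal NNReal InnerProductSpace Topology
open Summit.AnomalousDissipation.AnomalousDissipation.Theorems.SolenoidalFractalHomogenisation.RealisedQuasiStaticCellLaw

/-! ## The reversed (adjoint) carrier -/

/-- The carrier of the adjoint (backward) problem based at time `t₀`: `(r, x) ↦ −b(t₀ − r, x)`. -/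
def revCarrier (b : ℝ → VF) (t₀ : ℝ) : ℝ → VF := fun r x => -(b (t₀ - r) x)

/-- Unfolding `revCarrier`. [folklore] -/
@[simp] theorem revCarrier_apply (b : ℝ → VF) (t₀ r : ℝ) (x : UnitAddTorus (Fin 3)) :
    revCarrier b t₀ r x = -(b (t₀ - r) x) := rfl

/-- Sup bound WITH the `1/n`: `‖revCarrier (cellField …) t₀ r x‖ ≤ k/(2πn)` (`norm_cell_le_div`). [folklore] -/
theorem norm_revCarrier_cellField_le {k : ℕ} (W : LatticeWord k) (M : ℝ) (hM : 0 < M) {ν : ℝ} (hν : 0 < ν) {n : ℕ}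
    (hn : 0 < n) (t₀ r : ℝ) (x : UnitAddTorus (Fin 3)) :
    ‖revCarrier (cellField W M hM ν hν n) t₀ r x‖ ≤ k / (2 * Real.pi * n) := by
  rw [revCarrier_apply, norm_neg]
  exact norm_cell_le_div _ hn _ x

/-- Crude sup bound `‖revCarrier (cellField …) t₀ r x‖ ≤ k/(2π)` (`norm_cell_le`, any `n`). [folklore] -/
theorem norm_revCarrier_cellField_le' {k : ℕ} (W : LatticeWord k) (M : ℝ) (hM : 0 < M) {ν : ℝ} (hν : 0 < ν) (n : ℕ)
    (t₀ r : ℝ) (x : UnitAddTorus (Fin 3)) :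
    ‖revCarrier (cellField W M hM ν hν n) t₀ r x‖ ≤ k / (2 * Real.pi) := by
  rw [revCarrier_apply, norm_neg]
  exact norm_cell_le _ n _ x

/-- The reversed cell carrier is invariant under the `n`-torsion grid translations (`cell_add_grid`). [folklore] -/
theorem revCarrier_cellField_add_grid {k : ℕ} (W : LatticeWord k) (M : ℝ) (hM : 0 < M) {ν : ℝ} (hν : 0 < ν) {n : ℕ}
    (hn : 0 < n) (j : Fin 3 → Fin n) (t₀ r : ℝ) (x : UnitAddTorus (Fin 3)) :
    revCarrier (cellField W M hM ν hν n) t₀ r (x + fun i => ((((j i : ℕ) : ℝ) / n : ℝ) : UnitAddCircle)) =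
      revCarrier (cellField W M hM ν hν n) t₀ r x := by
  simp only [revCarrier_apply, cellField, cell_add_grid _ hn]

/-- The reversed cell carrier is jointly continuous on `ℝ × T³` (`continuous_uncurry_cell`). [folklore] -/
theorem continuous_uncurry_revCarrier_cellField {k : ℕ} (W : LatticeWord k) (M : ℝ) (hM : 0 < M) {ν : ℝ} (hν : 0 < ν)
    (n : ℕ) (t₀ : ℝ) : Continuous (uncurry (revCarrier (cellField W M hM ν hν n) t₀)) := by
  have e : uncurry (revCarrier (cellField W M hM ν hν n) t₀) =
      fun p : ℝ × UnitAddTorus (Fin 3) => -(uncurry (cellField W M hM ν hν n) (t₀ - p.1, p.2)) := by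
    funext ⟨r, x⟩
    rfl
  rw [e]
  exact ((continuous_uncurry_cell _ n).comp ((continuous_const.sub continuous_fst).prodMk continuous_snd)).neg

/-- The space–time lift of the reversed cell carrier is in `L^∞((0,T') × T³)`. [folklore] -/
theorem memLp_top_stLift_revCarrier_cellField {k : ℕ} (W : LatticeWord k) (M : ℝ) (hM : 0 < M) {ν : ℝ} (hν : 0 < ν)
    (n : ℕ) (t₀ T' : ℝ) :
    MemLp (FunctionSpaces.Torus.stLift (revCarrier (cellField W M hM ν hν n) t₀)) ∞
      (volume.restrict (Ioo 0 T' ×ˢ (univ : Set (EuclideanSpace ℝ (Fin 3))))) := by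
  have hc : Continuous (FunctionSpaces.Torus.stLift (revCarrier (cellField W M hM ν hν n) t₀)) := by
    have e : FunctionSpaces.Torus.stLift (revCarrier (cellField W M hM ν hν n) t₀) =
        uncurry (revCarrier (cellField W M hM ν hν n) t₀) ∘ Prod.map id FunctionSpaces.Torus.proj := by
      funext ⟨t, y⟩
      rfl
    rw [e]
    exact (continuous_uncurry_revCarrier_cellField W M hM hν n t₀).comp
      (continuous_id.prodMap FunctionSpaces.Torus.continuous_proj)
  exact memLp_top_of_bound hc.aestronglyMeasurable (k / (2 * Real.pi))
    (ae_of_all _ fun p => norm_revCarrier_cellField_le' W M hM hν n t₀ p.1 (FunctionSpaces.Torus.proj p.2))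

/-- **D1 (candidate Literature lemma, size L) — the duality pairing is constant.**  For a weak solution `u` of the tensor passive-vector
problem on `(0,T)` (tensor `𝔹` in an elliptic window, `L^∞` carrier `b`, `L²` weakly div-free datum `F`) and a weak solution `ψ` on `(0,t₀)`,
`t₀ ≤ T`, of the ADJOINT problem (tensor `majorTranspose 𝔹`, carrier `revCarrier b t₀`, `L²` weakly div-free datum `φ`), the pairing
`s ↦ ∫⟪u s, ψ (t₀ − s)⟫` is a.e. constant on `(0,t₀)`.  Proof route (mode-wise, no admissibility of `ψ` as a test): see the file docstring.
(Evans 2010, §7.1.2–7.1.3; PROVED in the tree as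
`Literature.Analysis.FluidPDE.Torus.IsWeakTensorPassiveVectorOn.exists_ae_integral_inner_reversed_eq_const`, p640160 — see `pairingConst` in
`…CellEnergyTDual`; kept here as the NAME of the intermediate statement the dual chain threads). -/
def PairingConst : Prop :=
  ∀ (T : ℝ) (𝔹 : Torus.Visc4 (Fin 3)) (lo hi : ℝ), Torus.NearIso 𝔹 lo hi → 0 < lo →
  ∀ (b : ℝ → VF), MemLp (FunctionSpaces.Torus.stLift b) ∞ (volume.restrict (Ioo 0 T ×ˢ (univ : Set (EuclideanSpace ℝ (Fin 3))))) →
  ∀ (F : VF) (u : ℝ → VF), MemLp F 2 volume → FunctionSpaces.Torus.IsWeaklyDivFree F →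
    Torus.IsWeakTensorPassiveVectorOn 0 T 𝔹 b F u →
  ∀ t₀ : ℝ, t₀ ∈ Ioc 0 T → ∀ (φ : VF) (ψ : ℝ → VF), MemLp φ 2 volume → FunctionSpaces.Torus.IsWeaklyDivFree φ →
    MemLp (FunctionSpaces.Torus.stLift (revCarrier b t₀)) ∞ (volume.restrict (Ioo 0 t₀ ×ˢ (univ : Set (EuclideanSpace ℝ (Fin 3))))) →
    Torus.IsWeakTensorPassiveVectorOn 0 t₀ (Torus.majorTranspose 𝔹) (revCarrier b t₀) φ ψ →
    ∃ c : ℝ, ∀ᵐ s ∂(volume.restrict (Ioo 0 t₀)), ∫ x, ⟪u s x, ψ (t₀ - s) x⟫_ℝ = c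

/-- **The duality bound** (consequence of D1–D3, proved below): for a.e. `t₀ ∈ (0,T)`, every adjoint solution `ψ` from the datum `φ` and
every a.e. bound `|∫⟪F, ψ r⟫| ≤ B` on `(0,t₀)` give `|∫⟪u t₀, φ⟫| ≤ B`. -/
def DualityBound : Prop :=
  ∀ (T : ℝ) (𝔹 : Torus.Visc4 (Fin 3)) (lo hi : ℝ), Torus.NearIso 𝔹 lo hi → 0 < lo →
  ∀ (b : ℝ → VF), MemLp (FunctionSpaces.Torus.stLift b) ∞ (volume.restrict (Ioo 0 T ×ˢ (univ : Set (EuclideanSpace ℝ (Fin 3))))) →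
  ∀ (F : VF) (u : ℝ → VF), MemLp F 2 volume → FunctionSpaces.Torus.IsWeaklyDivFree F →
    Torus.IsWeakTensorPassiveVectorOn 0 T 𝔹 b F u →
  ∀ φ : VF, MemLp φ 2 volume → FunctionSpaces.Torus.IsWeaklyDivFree φ →
    ∀ᵐ t₀ ∂(volume.restrict (Ioo 0 T)), ∀ ψ : ℝ → VF,
      MemLp (FunctionSpaces.Torus.stLift (revCarrier b t₀)) ∞ (volume.restrict (Ioo 0 t₀ ×ˢ (univ : Set (EuclideanSpace ℝ (Fin 3))))) →
      Torus.IsWeakTensorPassiveVectorOn 0 t₀ (Torus.majorTranspose 𝔹) (revCarrier b t₀) φ ψ →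
      ∀ B : ℝ, (∀ᵐ r ∂(volume.restrict (Ioo 0 t₀)), |∫ x, ⟪F x, ψ r x⟫_ℝ| ≤ B) → |∫ x, ⟪u t₀ x, φ x⟫_ℝ| ≤ B

/-- **`UniformSlowLeak` (candidate text of the (F) half of `stub_cellEnergyT`, size M given `DualityBound`, `CarrierFastContent`,
`exists_adjoint`)** — clause (F) of `CellEnergyClausesNoE` UNIFORMLY IN `T` with the explicit constant `36k²Λ²/(π⁴lo²c)`, for every
`0 < ν₀`, `2ν₀ ≤ K`.  Recipe: fix `ν, n, 𝔸, λ, L, F, T, u`; `2L < n` since `⌈K/ν⌉₊ ≥ 3`; for a.e. `t₀` (countably many `φ`'s: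
`ae_all_iff` over `ℓ ∈ ℤ³`, two transverse unit `p ⊥ ℓ`, `Re`/`Im`): `ψ` from `exists_adjoint`; `B := ‖P_{Σ(ℓ)}F‖·√D` bounds `|∫⟪F, ψ r⟫|`
a.e. by `CarrierFastContent` (`F̂` vanishes on `{±ℓ}`, `ψ r` lives on `Σ(ℓ) = {±ℓ}+nℤ³` by `ae_mFourierCoeff_eq_zero_off_sector`, Parseval
`FunctionSpaces.Torus` API as in `cell_corrector_content` §1/§4); `DualityBound` ⇒ `|∫⟪u t₀, φ⟫| ≤ B`; `sectorEnergy ℓ (u t₀) = Σ_p |p·û(ℓ)|²`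
(longitudinal part `0`: `ae_isWeaklyDivFree`); sum over the slow box of `lowEnergy L` (mode `0` vanishes by mean conservation; pair-sectors of
distinct pairs disjoint as `2L < n`; `‖ℓ‖² ≤ L²`, `λ ≤ Λ`). -/
def UniformSlowLeak : Prop :=
  ∀ (k : ℕ) (W : LatticeWord k) (M : ℝ) (hM : 0 < M) (c : ℝ), 0 < c →
  ∀ (lo hi Λ β : ℝ), 0 < lo → 1 ≤ Λ → ∀ (ν₀ K : ℝ), 0 < ν₀ → 2 * ν₀ ≤ K →
  ∀ ν, ∀ hν : ν ∈ Set.Ioo 0 ν₀, ∀ n : ℕ, ∀ 𝔸 : Torus.Visc4 (Fin 3),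
    Torus.OddSmall 𝔸 (ν * β) → (∃ lam ∈ Set.Icc (1:ℝ) Λ, Torus.NearIso 𝔸 (ν * (lo / lam)) (ν * (hi * lam))) →
    ∀ L > (0:ℝ), L * (⌈K / ν⌉₊ : ℝ) ≤ n → ∀ F : VF, IsDatum F →
      (∀ k' : Fin 3 → ℤ, ‖Torus.latticeVec k'‖ < (n:ℝ) / 2 → ∀ i, modeCoeff k' F i = 0) →
      ∀ T > (0:ℝ), ∀ u : ℝ → VF,
        Torus.IsWeakTensorPassiveVectorOn 0 T ((1 / (n:ℝ) ^ 2) • 𝔸) (cellField W M hM ν hν.1 n) F u →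
        ∀ᵐ t ∂(volume.restrict (Ioo 0 T)),
          lowEnergy L (u t) ≤ (36 * (k:ℝ) ^ 2 * Λ ^ 2 / (Real.pi ^ 4 * lo ^ 2 * c)) * (c * L ^ 2 / ((n:ℝ) ^ 2 * ν ^ 2)) *
            ∫ x, ‖F x‖ ^ 2

/-- **`SlowModeBound` (candidate text, size M — the content of the line).**  For every weak cell solution `u` from fluctuation data `F` (no modes
below `n/2`) and every slow mode `ℓ ≠ 0`, `2‖ℓ‖ < n`: `sectorEnergy ℓ (u t) ≤ 18k²λ²‖ℓ‖²/(π⁴n²ν²lo²) · ‖P_{Σ(ℓ)}F‖²` for a.e. `t`.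
Proof route: for the two transverse unit `p ⊥ ℓ` and `φ ∈ {Re e_ℓ·p, Im e_ℓ·p}` (`‖φ‖² = 1/2`): `ψ` from `exists_adjoint` (a.e. `t` as `t₀`),
`|∫⟪F, ψ r⟫| ≤ ‖P_{Σ(ℓ)}F‖·(9k²λ²‖ℓ‖²·(1/2)/(π⁴n²ν²lo²))^{1/2}` a.e. `r` by `CarrierFastContent` (§1 gives the carrier hypotheses; `ψ r` lives on
`Σ(ℓ)` by `ae_mFourierCoeff_eq_zero_off_sector`, `F̂(±ℓ) = 0`), `DualityBound`; then `|p·û(t)(ℓ)|² = ⟨u t, Re e_ℓ p⟩² + ⟨u t, Im e_ℓ p⟩²` and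
`ℓ·û(t)(ℓ) = 0` (`ae_isWeaklyDivFree`). -/
def SlowModeBound : Prop :=
  ∀ (k : ℕ) (W : LatticeWord k) (M : ℝ) (hM : 0 < M) (lo hi lam : ℝ), 0 < lo → 1 ≤ lam →
  ∀ (ν : ℝ) (hν : 0 < ν) (n : ℕ), 0 < n → ∀ 𝔸 : Torus.Visc4 (Fin 3), Torus.NearIso 𝔸 (ν * (lo / lam)) (ν * (hi * lam)) →
  ∀ F : VF, IsDatum F → (∀ k' : Fin 3 → ℤ, ‖Torus.latticeVec k'‖ < (n:ℝ) / 2 → ∀ i, modeCoeff k' F i = 0) →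
  ∀ (T : ℝ) (u : ℝ → VF), Torus.IsWeakTensorPassiveVectorOn 0 T ((1 / (n:ℝ) ^ 2) • 𝔸) (cellField W M hM ν hν n) F u →
  ∀ ℓ : Fin 3 → ℤ, ℓ ≠ 0 → 2 * ‖Torus.latticeVec ℓ‖ < n →
    ∀ᵐ t ∂(volume.restrict (Ioo 0 T)),
      sectorEnergy ℓ (u t) ≤
        18 * (k:ℝ) ^ 2 * lam ^ 2 * ‖Torus.latticeVec ℓ‖ ^ 2 / (Real.pi ^ 4 * (n:ℝ) ^ 2 * ν ^ 2 * lo ^ 2) * pairSectorEnergy n ℓ F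

/-- **`SectorCount` (candidate text, size S).**  The pair-sectors of distinct slow pairs `{±ℓ}` (`‖ℓ‖ ≤ L`, `2L < n`) are disjoint and
`Σ(ℓ) = Σ(−ℓ)`, so by Parseval `Σ_{0 ≠ ℓ ∈ slowBox L} ‖P_{Σ(ℓ)}F‖² ≤ 2‖F‖²`. -/
def SectorCount : Prop :=
  ∀ (n : ℕ) (L : ℝ), 0 < L → 2 * L < n → ∀ F : VF, IsDatum F →
    ∑ ℓ ∈ (slowBox L).erase 0, pairSectorEnergy n ℓ F ≤ 2 * ∫ x, ‖F x‖ ^ 2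

/-- **`MeanConservation` (candidate text, size S).**  The mean (mode `0`) of a weak solution of the tensor passive-vector problem is that of
its datum for a.e. `t` (`weak_eq` with the constant div-free tests `θ(t)·eᵢ`: `convect b (const) = 0`, `viscAdj 𝔹 (const) = 0`). -/
def MeanConservation : Prop :=
  ∀ (T : ℝ) (𝔹 : Torus.Visc4 (Fin 3)) (b : ℝ → VF),
    MemLp (FunctionSpaces.Torus.stLift b) ∞ (volume.restrict (Ioo 0 T ×ˢ (univ : Set (EuclideanSpace ℝ (Fin 3))))) →
  ∀ (w₀ : VF) (w : ℝ → VF), MemLp w₀ 2 volume → Torus.IsWeakTensorPassiveVectorOn 0 T 𝔹 b w₀ w →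
    ∀ᵐ t ∂(volume.restrict (Ioo 0 T)), ∀ i, modeCoeff 0 (w t) i = modeCoeff 0 w₀ i

/-- `SectorCount` BY NAME (p638936). -/
theorem sectorCount : SectorCount := sum_pairSectorEnergy_le

/-- `MeanConservation` BY NAME (p638532). -/
theorem meanConservation : MeanConservation := ae_modeCoeff_zero_eq

/-- The transverse test vectors `q_j = e_j − (ℓ_j/|ℓ|²) ℓ`. [this sketch] -/
def transVec (ℓ : Fin 3 → ℤ) (j : Fin 3) : EuclideanSpace ℝ (Fin 3) :=
  WithLp.toLp 2 fun i => (if i = j then (1:ℝ) else 0) - (ℓ j : ℝ) * (ℓ i : ℝ) / ‖Torus.latticeVec ℓ‖ ^ 2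

/-- Components of `transVec`. [folklore] -/
theorem transVec_apply (ℓ : Fin 3 → ℤ) (j i : Fin 3) :
    transVec ℓ j i = (if i = j then (1:ℝ) else 0) - (ℓ j : ℝ) * (ℓ i : ℝ) / ‖Torus.latticeVec ℓ‖ ^ 2 := rfl


/-- `‖ℓ‖² = Σ_i ℓ_i²`. [folklore] -/
theorem norm_latticeVec_sq_eq_sum (ℓ : Fin 3 → ℤ) : ‖Torus.latticeVec ℓ‖ ^ 2 = ∑ i, (ℓ i : ℝ) ^ 2 := by
  rw [norm_latticeVec_sq']; rfl

/-- `q_j ⊥ ℓ`. [this sketch] -/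
theorem sum_mul_transVec {ℓ : Fin 3 → ℤ} (hℓ : ℓ ≠ 0) (j : Fin 3) : ∑ i, (ℓ i : ℝ) * transVec ℓ j i = 0 := by
  have hL : ‖Torus.latticeVec ℓ‖ ^ 2 ≠ 0 := pow_ne_zero 2 (norm_latticeVec_pos_of_ne_zero hℓ).ne'
  simp only [transVec_apply, mul_sub, Finset.sum_sub_distrib, mul_ite, mul_one, mul_zero, Finset.sum_ite_eq',
    Finset.mem_univ, if_true]
  have e : ∑ i, (ℓ i : ℝ) * ((ℓ j : ℝ) * (ℓ i : ℝ) / ‖Torus.latticeVec ℓ‖ ^ 2) =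
      (ℓ j : ℝ) * (∑ i, (ℓ i : ℝ) ^ 2) / ‖Torus.latticeVec ℓ‖ ^ 2 := by
    rw [Finset.mul_sum, Finset.sum_div]
    exact Finset.sum_congr rfl fun i _ => by ring
  rw [e, ← norm_latticeVec_sq_eq_sum, mul_div_assoc, div_self hL, mul_one, sub_self]

/-- `Σ_j ‖q_j‖² = 2` (trace of the projection onto `ℓ^⊥`). [this sketch] -/
theorem sum_norm_sq_transVec {ℓ : Fin 3 → ℤ} (hℓ : ℓ ≠ 0) : ∑ j, ‖transVec ℓ j‖ ^ 2 = 2 := by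
  have hL : ‖Torus.latticeVec ℓ‖ ^ 2 ≠ 0 := pow_ne_zero 2 (norm_latticeVec_pos_of_ne_zero hℓ).ne'
  have hL' := norm_latticeVec_sq_eq_sum ℓ
  rw [Fin.sum_univ_three] at hL'
  rw [Fin.sum_univ_three, EuclideanSpace.norm_sq_eq (transVec ℓ 0), EuclideanSpace.norm_sq_eq (transVec ℓ 1),
    EuclideanSpace.norm_sq_eq (transVec ℓ 2)]
  simp only [Real.norm_eq_abs, sq_abs, transVec_apply, Fin.sum_univ_three]
  simp only [Fin.isValue, if_true, show ((0:Fin 3) = 1 ↔ False) by decide, show ((0:Fin 3) = 2 ↔ False) by decide,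
    show ((1:Fin 3) = 0 ↔ False) by decide, show ((1:Fin 3) = 2 ↔ False) by decide, show ((2:Fin 3) = 0 ↔ False) by decide,
    show ((2:Fin 3) = 1 ↔ False) by decide, if_false]
  rw [hL'] at hL ⊢
  field_simp
  ring

/-- The complexified test vector is transversal: `Σ_i ℓ_i z_i = 0`. [this sketch] -/
theorem sum_mul_complexify_transVec {ℓ : Fin 3 → ℤ} (hℓ : ℓ ≠ 0) (j : Fin 3) :
    ∑ i, (ℓ i : ℂ) * FunctionSpaces.EuclideanSpace.complexify (transVec ℓ j) i = 0 := by
  simp only [FunctionSpaces.EuclideanSpace.complexify_apply]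
  have h := sum_mul_transVec hℓ j
  have : ∑ i, (ℓ i : ℂ) * ((transVec ℓ j i : ℝ) : ℂ) = ((∑ i, (ℓ i : ℝ) * transVec ℓ j i : ℝ) : ℂ) := by push_cast; rfl
  rw [this, h]; simp

/-- Transversality is preserved by multiplication by `I`. [folklore] -/
theorem sum_mul_I_smul {ℓ : Fin 3 → ℤ} {z : EuclideanSpace ℂ (Fin 3)} (hz : ∑ i, (ℓ i : ℂ) * z i = 0) :
    ∑ i, (ℓ i : ℂ) * (Complex.I • z) i = 0 := by
  simp only [PiLp.smul_apply, smul_eq_mul]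
  have : ∑ i, (ℓ i : ℂ) * (Complex.I * z i) = Complex.I * ∑ i, (ℓ i : ℂ) * z i := by
    rw [Finset.mul_sum]; exact Finset.sum_congr rfl fun i _ => by ring
  rw [this, hz, mul_zero]

/-- For a transversal `v` (`ℓ · v = 0`): `⟪v, q_jℂ⟫ = conj (v j)`. [this sketch] -/
theorem inner_complexify_transVec {ℓ : Fin 3 → ℤ} (hℓ : ℓ ≠ 0) {v : EuclideanSpace ℂ (Fin 3)}
    (hv : ∑ i, (ℓ i : ℂ) * v i = 0) (j : Fin 3) :
    ⟪v, FunctionSpaces.EuclideanSpace.complexify (transVec ℓ j)⟫_ℂ = starRingEnd ℂ (v j) := by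
  have hL : (‖Torus.latticeVec ℓ‖ ^ 2 : ℂ) ≠ 0 := by exact_mod_cast pow_ne_zero 2 (norm_latticeVec_pos_of_ne_zero hℓ).ne'
  simp only [PiLp.inner_apply, RCLike.inner_apply, FunctionSpaces.EuclideanSpace.complexify_apply, transVec_apply,
    Complex.ofReal_sub, apply_ite Complex.ofReal, Complex.ofReal_one, Complex.ofReal_zero, Complex.ofReal_div,
    Complex.ofReal_mul, Complex.ofReal_intCast, Complex.ofReal_pow]
  simp only [sub_mul, Finset.sum_sub_distrib, ite_mul, one_mul, zero_mul, Finset.sum_ite_eq', Finset.mem_univ, if_true]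
  have e : ∑ i, (ℓ j : ℂ) * (ℓ i : ℂ) / (‖Torus.latticeVec ℓ‖ : ℂ) ^ 2 * starRingEnd ℂ (v i) =
      (ℓ j : ℂ) / (‖Torus.latticeVec ℓ‖ : ℂ) ^ 2 * starRingEnd ℂ (∑ i, (ℓ i : ℂ) * v i) := by
    rw [map_sum, Finset.mul_sum]
    refine Finset.sum_congr rfl fun i _ => ?_
    rw [map_mul, map_intCast]
    field_simp
  rw [e, hv, map_zero, mul_zero, sub_zero]

/-- `(Re w)² + (Re (I w))² = ‖w‖²`. [folklore] -/
theorem re_sq_add_re_I_mul_sq (w : ℂ) : w.re ^ 2 + (Complex.I * w).re ^ 2 = ‖w‖ ^ 2 := by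
  rw [Complex.I_mul_re, Complex.sq_norm, Complex.normSq_apply]; ring

end Summit.AnomalousDissipation.AnomalousDissipation.Theorems.SolenoidalFractalHomogenisation.LagrangianStep.CellEnergyT

end
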